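/-
COR-CM (cell pub-hodgecm2, stage 2 of the Hodge ladder) — count-neutral kernel combinatorics (seat prover-pub-hodgecm2-b23-g57-0, binder
prover b23, gen 57; lane SYLOW TRANSFER XVI «the odd central factor — floor, fibre and block count», blanket `Census/SylowTransfer*`
HOME/INBOX.md l.23357, claim l.26753).  Theorems only, pure group theory on lit-andre-3ʼs intrinsic `𝒦` and b09ʼs Burnside count (consumed
BY NAME, nothing restated); no definition, no certificate, no `decide`, no named fact, no geometry, no `sorry`.  `Interfaces.lean` (C1), every
E term, B01 and `Transposition/*` are untouched.
HONEST FRAMING: `HC_CM` is NOT proved, here or anywhere in the tree; nothing here is a period or a headline.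
-/
import Summits.HodgeConjecture.CorCM.Census.TypeStabiliserCharK
import Summits.HodgeConjecture.CorCM.Census.BlockParityBurnside

/-!
# Sylow transfer, XVI: the odd central factor `G = H × A` (`|A|` odd) — `𝒦`, `d₂`, the block count and the coinvariant fibre

The successor menus of gens 45–56 all end at rows of the shape «`2`-group × odd cyclic group»: `D(ℤ/8) × C₃ = (24,7)` (gen 56ʼs first open mixed
twist), `Q₁₆ × C₃`, `SD₁₆ × C₃`, `D₄ × C₃²`, … .  This file computes the FLOOR of every such row from the `2`-group alone, purely group-theoretically:
for `G = H × A` with `c = (c_H, 1)`, `c_H` a central involution of `H` and `|A|` odd (`A` any finite group),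

* §1 `prod_mem_zpowers_prod_iff`: `(c,1) ∈ ⟨(h,a)⟩ ↔ c ∈ ⟨h⟩` (the odd order of `a` is absorbed: `(h,a)^{k·ord a} = (cᵒʳᵈ ᵃ, 1) = (c, 1)`).
* §2 **`𝒦(H × A) = 𝒦(H) × A`** (`stabGen_prod`; lit-andre-3ʼs `𝒦 = ⟨c, {g : c ∉ ⟨g⟩}⟩` of `Census/TypeStabiliserSubgroup.lean`), hence
  **`d₂(H × A) = d₂(H)`** (`indexTwoRank_prod_top`: `(H × A)/(K × A) ≅ H/K`, and `#Hom(·, ℤ/2) = 2^{d₂}`).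
* §3 **THE FIBRE**: `φ₂(H × A) + 2 = β(H × A) + d₂(H)` (`fibreTwo_prod_add_two`; lit-andre-3ʼs `fibreTwo_add_two_eq_card_block_add_indexTwoRank` on
  `H × A`), and `φ₂(H × A) + β(H) = φ₂(H) + β(H × A)` (`fibreTwo_prod_add_card_block`): the odd factor moves `φ₂` exactly as it moves `β`.
* §4 **THE BLOCK COUNT** (`card_block_prod_mul_card`): `β(H × A)·|H|·|A| = Σ_{h,a} [c ∉ ⟨h⟩]·2^{|H||A| / lcm(ord h, ord a) / 2}` (b09ʼs Burnside count
  `BlockParity.card_block_mul_card` on `H × A`); for `|A| = p` prime with `p ∤ |H|` (`card_block_prod_mul_card_of_prime`):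
  **`β(H × A)·|H|·p = Σ_h [c ∉ ⟨h⟩]·2^{|H|·p / ord h / 2} + (p − 1)·β(H)·|H|`**.
Rows (index-two cyclic `2`-groups `× C_p`, e.g. `D₈ × C₃`: `β = 350224`, `φ₂ = 350222`) are part XVII.  What this does NOT do: no generating family,
no law `μ = φ₂` for these rows (open; by gen 49 IX `μ(D(ℤ/8) × C₃) ∈ {φ₂, φ₂ + 1}`).
All [folklore] bookkeeping over [Pohlmann1968, Thm 1] in the reading of [Milne1999, Prop. 2.1].

## References
* [Pohlmann1968] H. Pohlmann, Algebraic cycles on abelian varieties of complex multiplication type, Ann. of Math. 88 (1968), Thm 1.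
* [Milne1999] J. S. Milne, Lefschetz motives and the Tate conjecture, Compositio Math. 117 (1999), Prop. 2.1, p. 54.
-/

namespace Summit.HodgeConjecture.CorCM.Census.SylowTransfer

open Finset
open Summit.HodgeConjecture.CorCM.Prior.AllgGroup.RfwfAllgGroup
open Summit.HodgeConjecture.CorCM.Census.BlockParity
open Summit.HodgeConjecture.CorCM.Census.Coinvariant
open Summit.HodgeConjecture.CorCM.Census.TypeStabiliser
open Summit.HodgeConjecture.CorCM.Census.IndexTwo

noncomputable section

section Group

variable {H A : Type*} [Group H] [Group A]

/-! ## §1 Cyclic subgroups of `H × A` and the involution `(c, 1)` -/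

/-- `(c, 1)·(c, 1) = 1` in `H × A`. [folklore] -/
theorem prod_c_mul_c {c : H} (hc2 : c * c = 1) : ((c, (1 : A)) : H × A) * (c, 1) = 1 := by
  rw [Prod.mk_mul_mk, hc2, mul_one]; rfl

/-- `(c, 1) ≠ 1` in `H × A`. [folklore] -/
theorem prod_c_ne_one {c : H} (hc1 : c ≠ 1) : ((c, (1 : A)) : H × A) ≠ 1 := fun h => hc1 (Prod.mk.inj h).1

/-- `(c, 1)` is central in `H × A` when `c` is central in `H`. [folklore] -/
theorem prod_c_comm {c : H} (hcen : ∀ x : H, x * c = c * x) (g : H × A) : g * (c, 1) = (c, 1) * g := by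
  obtain ⟨h, a⟩ := g
  rw [Prod.mk_mul_mk, Prod.mk_mul_mk, mul_one, one_mul, hcen]

/-- Components of integer powers in `H × A` (definitional). [folklore] -/
theorem fst_zpow_prod (g : H × A) (k : ℤ) : (g ^ k).1 = g.1 ^ k := rfl

/-- Components of integer powers in `H × A` (definitional). [folklore] -/
theorem snd_zpow_prod (g : H × A) (k : ℤ) : (g ^ k).2 = g.2 ^ k := rfl

/-- An odd power of an involution is the involution. [folklore] -/
theorem pow_eq_self_of_odd {c : H} (hc2 : c * c = 1) {n : ℕ} (hn : Odd n) : c ^ n = c := by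
  obtain ⟨j, rfl⟩ := hn
  rw [pow_succ, pow_mul, pow_two, hc2, one_pow, one_mul]

/-- **`(c,1) ∈ ⟨(h,a)⟩ ↔ c ∈ ⟨h⟩`** when `a` has odd order: the odd order of `a` is absorbed by `(h,a)^{k·ord a} = (c^{ord a}, 1) = (c,1)`. [folklore] -/
theorem prod_mem_zpowers_prod_iff {c : H} (hc2 : c * c = 1) (h : H) {a : A} (ha : Odd (orderOf a)) :
    ((c, (1 : A)) : H × A) ∈ Subgroup.zpowers (h, a) ↔ c ∈ Subgroup.zpowers h := by
  constructor
  · intro hc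
    obtain ⟨k, hk⟩ := Subgroup.mem_zpowers_iff.mp hc
    refine Subgroup.mem_zpowers_iff.mpr ⟨k, ?_⟩
    have := congrArg Prod.fst hk
    rwa [fst_zpow_prod] at this
  · intro hc
    obtain ⟨k, hk⟩ := Subgroup.mem_zpowers_iff.mp hc
    refine Subgroup.mem_zpowers_iff.mpr ⟨k * (orderOf a : ℤ), ?_⟩
    rw [zpow_mul]
    refine Prod.ext ?_ ?_
    · rw [fst_zpow_prod, fst_zpow_prod, hk, zpow_natCast, pow_eq_self_of_odd hc2 ha]
    · rw [snd_zpow_prod, snd_zpow_prod, ← zpow_mul, mul_comm, zpow_mul, zpow_natCast, pow_orderOf_eq_one, one_zpow]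

/-- `(c,1) ∉ ⟨(1,a)⟩` for `c ≠ 1`. [folklore] -/
theorem prod_c_notMem_zpowers_inr {c : H} (hc1 : c ≠ 1) (a : A) : ((c, (1 : A)) : H × A) ∉ Subgroup.zpowers ((1, a) : H × A) := by
  intro hc
  obtain ⟨k, hk⟩ := Subgroup.mem_zpowers_iff.mp hc
  have := congrArg Prod.fst hk
  rw [fst_zpow_prod, one_zpow] at this
  exact hc1 this.symm

/-- In a finite group of odd order every element has odd order. [folklore] -/
theorem odd_orderOf_of_odd_card [Finite A] (hA : Odd (Nat.card A)) (a : A) : Odd (orderOf a) :=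
  Odd.of_dvd_nat hA (orderOf_dvd_natCard a)

/-! ## §2 `𝒦(H × A) = 𝒦(H) × A` and `d₂(H × A) = d₂(H)` -/

/-- `𝒦(H) ≤ 𝒦(H × A)` along the first inclusion. [folklore] -/
theorem stabGen_le_comap_inl {c : H} (hc2 : c * c = 1) :
    stabGen c ≤ (stabGen ((c, (1 : A)) : H × A)).comap (MonoidHom.inl H A) := by
  rw [stabGen, Subgroup.closure_le]
  intro g hg
  rw [SetLike.mem_coe, Subgroup.mem_comap, MonoidHom.inl_apply]
  rcases hg with hg | hg
  · rw [Set.mem_singleton_iff] at hg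
    subst hg
    exact self_mem_stabGen _
  · exact mem_stabGen_of_notMem_zpowers _ fun hc => hg ((prod_mem_zpowers_prod_iff hc2 g (by rw [orderOf_one]; exact odd_one)).mp hc)

/-- **`𝒦(H × A) = 𝒦(H) × A`** (`c ≠ 1` an involution of `H`, every element of `A` of odd order). [folklore] -/
theorem stabGen_prod {c : H} (hc2 : c * c = 1) (hc1 : c ≠ 1) (hA : ∀ a : A, Odd (orderOf a)) :
    stabGen ((c, (1 : A)) : H × A) = (stabGen c).prod ⊤ := by
  apply le_antisymm
  · rw [stabGen, Subgroup.closure_le]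
    rintro ⟨h, a⟩ hx
    rw [SetLike.mem_coe, Subgroup.mem_prod]
    refine ⟨?_, Subgroup.mem_top a⟩
    rcases hx with hx | hx
    · rw [Set.mem_singleton_iff] at hx
      rw [(Prod.mk.inj hx).1]
      exact self_mem_stabGen c
    · exact mem_stabGen_of_notMem_zpowers c fun hc => hx ((prod_mem_zpowers_prod_iff hc2 h (hA a)).mpr hc)
  · rintro ⟨h, a⟩ hx
    rw [Subgroup.mem_prod] at hx
    have e : ((h, a) : H × A) = (h, 1) * (1, a) := by rw [Prod.mk_mul_mk, mul_one, one_mul]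
    rw [e]
    exact mul_mem (stabGen_le_comap_inl hc2 hx.1) (mem_stabGen_of_notMem_zpowers _ (prod_c_notMem_zpowers_inr hc1 a))

/-- **`d₂((H × A)/(K × A)) = d₂(H/K)`** for a normal subgroup `K ⊴ H`: `(H × A)/(K × A) ≅ H/K` and `#Hom(·, ℤ/2) = 2^{d₂}`. [folklore] -/
theorem indexTwoRank_prod_top [Finite H] [Finite A] (K : Subgroup H) [hK : K.Normal] :
    indexTwoRank (K.prod (⊤ : Subgroup A)) = indexTwoRank K := by
  set φ : H × A →* H ⧸ K := (QuotientGroup.mk' K).comp (MonoidHom.fst H A) with hφdef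
  have hφ : Function.Surjective φ := by
    intro q
    obtain ⟨h, rfl⟩ := QuotientGroup.mk_surjective q
    exact ⟨(h, 1), rfl⟩
  have hker : φ.ker = K.prod ⊤ := by
    ext ⟨h, a⟩
    rw [MonoidHom.mem_ker, Subgroup.mem_prod, hφdef, MonoidHom.comp_apply, MonoidHom.coe_fst, QuotientGroup.mk'_apply,
      QuotientGroup.eq_one_iff]
    exact ⟨fun hh => ⟨hh, Subgroup.mem_top a⟩, fun hh => hh.1⟩
  haveI : (K.prod (⊤ : Subgroup A)).Normal := by rw [← hker]; infer_instance
  have e : (H × A) ⧸ K.prod (⊤ : Subgroup A) ≃* H ⧸ K :=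
    (QuotientGroup.quotientMulEquivOfEq hker.symm).trans (QuotientGroup.quotientKerEquivOfSurjective φ hφ)
  have hc : Nat.card ((H × A) ⧸ K.prod (⊤ : Subgroup A) →* Multiplicative (ZMod 2)) =
      Nat.card (H ⧸ K →* Multiplicative (ZMod 2)) :=
    Nat.card_congr (MulEquiv.monoidHomCongrLeftEquiv e)
  rw [card_signChar_quotient, card_signChar_quotient] at hc
  exact Nat.pow_right_injective le_rfl hc

/-- **`d₂(H × A) = d₂(H)`** for the involution `(c, 1)`, `c` central in `H`, `A` of odd element orders. [folklore] -/
theorem indexTwoRank_stabGen_prod [Finite H] [Finite A] {c : H} (hc2 : c * c = 1) (hc1 : c ≠ 1) (hcen : ∀ x : H, x * c = c * x)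
    (hA : ∀ a : A, Odd (orderOf a)) :
    indexTwoRank (stabGen ((c, (1 : A)) : H × A)) = indexTwoRank (stabGen c) := by
  haveI := stabGen_normal c hcen
  rw [stabGen_prod hc2 hc1 hA, indexTwoRank_prod_top]

end Group

/-! ## §3 The coinvariant fibre of `H × A` -/

section Fibre

variable {H A : Type*} [Group H] [Fintype H] [DecidableEq H] [Group A] [Fintype A] [DecidableEq A]

omit [Group H] [DecidableEq H] [Group A] [DecidableEq A] in
/-- `|H × A| / 2` is even when `4 ∣ |H|`. [folklore] -/
theorem even_card_prod_div_two (h4 : 4 ∣ Fintype.card H) : Even (Fintype.card (H × A) / 2) := by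
  rw [Fintype.card_prod]
  obtain ⟨k, hk⟩ := h4
  refine ⟨k * Fintype.card A, ?_⟩
  rw [hk, show 4 * k * Fintype.card A = 2 * (k * Fintype.card A + k * Fintype.card A) by ring]
  exact Nat.mul_div_cancel_left _ (by norm_num)

/-- **THE FIBRE OF AN ODD CENTRAL FACTOR: `φ₂(H × A) + 2 = β(H × A) + d₂(H)`** (`c` a central involution of `H`, `4 ∣ |H|`, `|A|` odd). [folklore] -/
theorem fibreTwo_prod_add_two (c : H) (hc2 : c * c = 1) (hc1 : c ≠ 1) (hcen : ∀ x : H, x * c = c * x) (h4 : 4 ∣ Fintype.card H)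
    (hA : Odd (Fintype.card A)) :
    fibreTwo ((c, (1 : A)) : H × A) (prod_c_mul_c hc2) + 2 =
      Fintype.card (Block ((c, (1 : A)) : H × A)) + indexTwoRank (stabGen c) := by
  have hA' : ∀ a : A, Odd (orderOf a) := fun a => odd_orderOf_of_odd_card (by rw [Nat.card_eq_fintype_card]; exact hA) a
  rw [← indexTwoRank_stabGen_prod hc2 hc1 hcen hA']
  exact fibreTwo_add_two_eq_card_block_add_indexTwoRank _ (prod_c_mul_c hc2) (prod_c_ne_one hc1) (prod_c_comm hcen)
    (even_card_prod_div_two h4)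

/-- **`φ₂(H × A) + β(H) = φ₂(H) + β(H × A)`**: the odd factor moves the coinvariant fibre exactly as it moves the block count. [folklore] -/
theorem fibreTwo_prod_add_card_block (c : H) (hc2 : c * c = 1) (hc1 : c ≠ 1) (hcen : ∀ x : H, x * c = c * x) (h4 : 4 ∣ Fintype.card H)
    (hA : Odd (Fintype.card A)) :
    fibreTwo ((c, (1 : A)) : H × A) (prod_c_mul_c hc2) + Fintype.card (Block c) =
      fibreTwo c hc2 + Fintype.card (Block ((c, (1 : A)) : H × A)) := by
  have hG := fibreTwo_prod_add_two c hc2 hc1 hcen h4 hA (A := A)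
  have hevenH : Even (Fintype.card H / 2) := by
    obtain ⟨k, hk⟩ := h4
    exact ⟨k, by rw [hk, show 4 * k = 2 * (k + k) by ring]; exact Nat.mul_div_cancel_left _ (by norm_num)⟩
  have hH := fibreTwo_add_two_eq_card_block_add_indexTwoRank c hc2 hc1 hcen hevenH
  omega

end Fibre

/-! ## §4 The block count of `H × A` -/

section Blocks

variable {H A : Type*} [Group H] [Fintype H] [DecidableEq H] [Group A] [Fintype A] [DecidableEq A]

/-- **THE BLOCK COUNT OF `H × A`** (Burnside on `H × A`, read through §1): `β(H × A)·(|H|·|A|) = Σ_{h,a} [c ∉ ⟨h⟩]·2^{|H||A| / lcm(ord h, ord a) / 2}`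
(`c` central involution of `H`, every element of `A` of odd order). [folklore] -/
theorem card_block_prod_mul_card (c : H) (hc2 : c * c = 1) (hcen : ∀ x : H, x * c = c * x) (hA : ∀ a : A, Odd (orderOf a)) :
    Fintype.card (Block ((c, (1 : A)) : H × A)) * (Fintype.card H * Fintype.card A) =
      ∑ h : H, ∑ a : A, if c ∈ Subgroup.zpowers h then 0
        else 2 ^ (Fintype.card H * Fintype.card A / Nat.lcm (orderOf h) (orderOf a) / 2) := by
  have h := card_block_mul_card ((c, (1 : A)) : H × A) (prod_c_mul_c hc2) (prod_c_comm hcen)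
  rw [Fintype.card_prod, Fintype.sum_prod_type] at h
  rw [h]
  refine Finset.sum_congr rfl fun x _ => Finset.sum_congr rfl fun a _ => ?_
  rw [Prod.orderOf_mk]
  by_cases hx : c ∈ Subgroup.zpowers x
  · rw [if_pos hx, if_pos ((prod_mem_zpowers_prod_iff hc2 x (hA a)).mpr hx)]
  · rw [if_neg hx, if_neg (fun h' => hx ((prod_mem_zpowers_prod_iff hc2 x (hA a)).mp h'))]

/-- A sum over a finite group of a function that is constant off the identity. [folklore] -/
theorem sum_ite_eq_one (X Y : ℕ) : (∑ a : A, if a = 1 then X else Y) = X + (Fintype.card A - 1) * Y := by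
  classical
  rw [Finset.sum_ite, Finset.sum_const, Finset.sum_const, smul_eq_mul, smul_eq_mul, Finset.filter_eq' univ (1 : A), if_pos (mem_univ _),
    Finset.card_singleton, one_mul, Finset.filter_ne' univ (1 : A), Finset.card_erase_of_mem (mem_univ _), Finset.card_univ]

/-- **THE BLOCK COUNT OF `H × C_p`** (`|A| = p` prime, `p ∤ |H|`): `β(H × A)·|H|·p = Σ_h [c ∉ ⟨h⟩]·2^{|H|·p / ord h / 2} + (p − 1)·β(H)·|H|`.
[folklore] -/
theorem card_block_prod_mul_card_of_prime (c : H) (hc2 : c * c = 1) (hcen : ∀ x : H, x * c = c * x) {p : ℕ} (hp : p.Prime)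
    (hA : Fintype.card A = p) (hpH : ¬ p ∣ Fintype.card H) (hp2 : p ≠ 2) :
    Fintype.card (Block ((c, (1 : A)) : H × A)) * (Fintype.card H * p) =
      (∑ h : H, if c ∈ Subgroup.zpowers h then 0 else 2 ^ (Fintype.card H * p / orderOf h / 2)) +
        (p - 1) * (Fintype.card (Block c) * Fintype.card H) := by
  have hodd : Odd p := hp.odd_of_ne_two hp2
  have hordA : ∀ a : A, a ≠ 1 → orderOf a = p := fun a ha => by
    have hdvd : orderOf a ∣ p := by rw [← hA]; exact orderOf_dvd_card
    rcases (Nat.dvd_prime hp).mp hdvd with h1 | h1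
    · exact absurd (orderOf_eq_one_iff.mp h1) ha
    · exact h1
  have hA' : ∀ a : A, Odd (orderOf a) := fun a => by
    by_cases ha : a = 1
    · rw [ha, orderOf_one]; exact odd_one
    · rw [hordA a ha]; exact hodd
  rw [← hA, card_block_prod_mul_card c hc2 hcen hA', card_block_mul_card c hc2 hcen, Finset.mul_sum, ← Finset.sum_add_distrib]
  refine Finset.sum_congr rfl fun h _ => ?_
  -- the inner sum over `A`
  have hcop : Nat.Coprime (orderOf h) p := by
    rw [Nat.coprime_comm, hp.coprime_iff_not_dvd]
    exact fun hd => hpH (hd.trans orderOf_dvd_card)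
  have hinner : ∀ a : A, (if c ∈ Subgroup.zpowers h then 0
      else 2 ^ (Fintype.card H * Fintype.card A / Nat.lcm (orderOf h) (orderOf a) / 2)) =
      if a = 1 then (if c ∈ Subgroup.zpowers h then 0 else 2 ^ (Fintype.card H * p / orderOf h / 2))
        else (if c ∈ Subgroup.zpowers h then 0 else 2 ^ (Fintype.card H / orderOf h / 2)) := by
    intro a
    by_cases ha : a = 1
    · rw [if_pos ha, ha, orderOf_one, Nat.lcm_one_right, hA]
    · rw [if_neg ha, hordA a ha, hcop.lcm_eq_mul, hA,
        Nat.mul_div_mul_right _ _ hp.pos]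
  rw [Finset.sum_congr rfl (fun a _ => hinner a), sum_ite_eq_one, hA]

end Blocks

end

end Summit.HodgeConjecture.CorCM.Census.SylowTransfer
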